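import Literature.AnabelianGeometry.SemiGraphs.RelativeGluedCoveringsTempered
import Literature.AnabelianGeometry.SemiGraphs.TemperedVerticialDistinct
import Literature.AnabelianGeometry.SemiGraphs.Temperoids
import HarnessLib

/-!
# [SemiAnbd] Theorem 3.7 (ii), same vertex: `π̂₁(G_v) ∩ g π̂₁(G_v) g⁻¹` has infinite index in
# `π̂₁(G_v)` for `g ∉ π̂₁(G_v)`

Mochizuki, *Semi-graphs of anabelioids*, Publ. RIMS **42** (2006), §3, manuscript p. 40
[cite: MochizukiSemiAnbd2006, Thm 3.7(ii) p.40]: verticial subgroups "that arise from distinct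
parametrization data" — here the same vertex `v` and distinct cosets `g₁ π̂₁(G_v) ≠ g₂ π̂₁(G_v)` —
meet in a subgroup of infinite index.  Print: Corollary 2.7 (i) / Remark 2.7.2, whose proof (p. 30)
passes to a covering `G' → G` in which `g` moves the relevant vertex over `v` and applies
Proposition 2.6 there.  The same argument is run here directly in `B^temp(G)` (local presentation):
the covering `G'` is the tempered covering `S₀` attached by the chart to `Π/V`, `V` an open normal
subgroup of `Π = π₁^temp(G)` with `g ∉ π̂₁(G_v)·V` (`exists_openNormalSubgroup_forall_not_mem`); the
vertices of `G'` over `v` are the `Π_v`-orbits of `(S₀)_v`, all with stabiliser `U = ψ⁻¹(V)`; the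
covering `G''` of p. 28 is glued RELATIVE to `S₀` (`RelativeGluedCoverings.lean`) with the
`Π'_v/N`-part over the orbit `O₁` of a point `y₁` only.  On the chart image `X` of `G''`: the point
`x₀` over `y₁` at `1·N` has isotropy in `H = ψ(Π_v)` surjecting onto `N ∩ Π'(U)`; an element of
`H ∩ gHg⁻¹` fixing `x₀` is `g ψ(δ) g⁻¹` with `ψ(δ)` fixing `g⁻¹x₀`, which lies over the orbit of
the point of `(S₀)_v` above `g⁻¹·[1]` — NOT `O₁`, as `g ∉ HV` — where the fibres are universal, so
`δ ∈ U ∩ Ker(Π_v → Π'_v)` acts trivially on `G''_v`, hence `g ψ(δ) g⁻¹` acts trivially on `X`; the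
counting of p. 29 then bounds `[N ∩ Π'(U) : 1]` by `[H : H ∩ gHg⁻¹]`, contradicting the choice of
`N` (elevatedness of `v`, with `[N : 1] > [H : H ∩ gHg⁻¹]·[Π_v : U]`).  Results:
`relIndex_conj_eq_zero`, the same-vertex clause `relIndex_conj_conj_eq_zero`, and the named fact
`verticialDistinct_holds : VerticialDistinct` (with `TemperedVerticialDistinct.lean`).
-/

open CategoryTheory Topology

namespace Literature.AnabelianGeometry.SemiGraphs

namespace ProfiniteSemiGraph

universe u

variable {𝒢 : ProfiniteSemiGraph.{u}}

/-- In a finite group, `[N : 1] ≤ [N ∩ W : 1] · [F : W]`. [folklore] -/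
private theorem card_le_card_inf_mul_index {F : Type*} [Group F] [Finite F] (N W : Subgroup F) :
    Nat.card N ≤ Nat.card ↥(N ⊓ W) * W.index := by
  have h1 : Nat.card ↥(N ⊓ W) * (N ⊓ W).relIndex N = Nat.card N := by
    have := Subgroup.card_mul_index (N ⊓ W)
    rw [← Subgroup.relIndex_mul_index (inf_le_left : N ⊓ W ≤ N), ← mul_assoc,
      ← Subgroup.card_mul_index N] at this
    exact Nat.eq_of_mul_eq_mul_right (Nat.pos_of_ne_zero Subgroup.index_ne_zero_of_finite) this
  have h2 : (N ⊓ W).relIndex N ≤ W.index := by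
    rw [inf_comm, Subgroup.inf_relIndex_right, ← Subgroup.relIndex_top_right]
    exact Subgroup.relIndex_le_of_le_right le_top
      (by rw [Subgroup.relIndex_top_right]; exact Subgroup.index_ne_zero_of_finite)
  calc Nat.card N = Nat.card ↥(N ⊓ W) * (N ⊓ W).relIndex N := h1.symm
    _ ≤ Nat.card ↥(N ⊓ W) * W.index := Nat.mul_le_mul_left _ h2

/-- `f(U ∩ f⁻¹N) = f(U) ∩ N`. [folklore] -/
private theorem map_inf_comap_eq {G F : Type*} [Group G] [Group F] (f : G →* F)
    (U : Subgroup G) (N : Subgroup F) : (U ⊓ N.comap f).map f = U.map f ⊓ N := by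
  refine le_antisymm (le_inf (Subgroup.map_mono inf_le_left)
    ((Subgroup.map_mono inf_le_right).trans (Subgroup.map_comap_le f N))) ?_
  rintro x ⟨⟨u, hu, rfl⟩, hx⟩
  exact ⟨u, ⟨hu, hx⟩, rfl⟩

/-- **Theorem 3.7 (ii), same vertex** ([SemiAnbd] p. 40; the proof of Cor. 2.7 (i), p. 30, run in
`B^temp(G)`): for `G` as in Proposition 3.6 (only "totally elevated" is used), a verticial
homomorphism `ψ : Π_v → π₁^temp(G)` with image `H`, and `g ∉ H`, the subgroup `H ∩ g H g⁻¹` has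
infinite index in `H`.
[cite: MochizukiSemiAnbd2006, Thm 3.7(ii) p.40] -/
theorem relIndex_conj_eq_zero (h𝒢 : 𝒢.Prop36Hypotheses) (c : TemperedPiChart 𝒢)
    (v : 𝒢.graph.Vertex) {ψ : 𝒢.Gv v →ₜ* c.G} (hψ : IsVerticialHom c v ψ) {g : c.G}
    (hg : g ∉ ψ.toMonoidHom.range) :
    ((ψ.toMonoidHom.range).map (MulAut.conj g).toMonoidHom).relIndex ψ.toMonoidHom.range = 0 := by
  classical
  set H : Subgroup c.G := ψ.toMonoidHom.range with hHdef
  by_contra hn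
  -- `K₀ = ψ⁻¹(g H g⁻¹)`, of finite index `[H : H ∩ gHg⁻¹]`
  set K₀ : Subgroup (𝒢.Gv v) := (H.map (MulAut.conj g).toMonoidHom).comap ψ.toMonoidHom
    with hK₀def
  have hK₀ : K₀.index = (H.map (MulAut.conj g).toMonoidHom).relIndex H :=
    Subgroup.index_comap _ _
  have hK₀ne : K₀.index ≠ 0 := hK₀ ▸ hn
  have hK₀mem : ∀ γ : 𝒢.Gv v, γ ∈ K₀ → ∃ δ : 𝒢.Gv v, g * ψ δ * g⁻¹ = ψ γ := by
    intro γ hγ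
    obtain ⟨h, ⟨δ, rfl⟩, hh⟩ := Subgroup.mem_map.mp (Subgroup.mem_comap.mp hγ)
    exact ⟨δ, hh⟩
  -- STEP 1: an open normal `V ⊆ Π` of countable index with `g ∉ H·V`
  haveI := c.t2Space
  have hHc : IsCompact (H : Set c.G) := by
    rw [hHdef, MonoidHom.coe_range]
    exact isCompact_range ψ.continuous
  obtain ⟨V, -, hV⟩ := c.exists_openNormalSubgroup_forall_not_mem hHc (show g ∉ (H : Set c.G) from hg)
  -- STEP 2: the tempered covering `S₀` attached to `Π/V`, and `U = ψ⁻¹(V)`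
  let X₀ : BTemp c.G := BTemp.quotientObj c.G c.isTempered V.toSubgroup V.isOpen
  let S₀ : BTempCat 𝒢 := c.equiv.inverse.obj X₀
  let U : Subgroup (𝒢.Gv v) := V.toSubgroup.comap ψ.toMonoidHom
  have hUopen : IsOpen (U : Set (𝒢.Gv v)) := V.isOpen.preimage ψ.continuous
  haveI : Finite (𝒢.Gv v ⧸ U) := Subgroup.quotient_finite_of_isOpen U hUopen
  haveI hUfi : U.FiniteIndex := Subgroup.finiteIndex_of_finite_quotient
  have hUne : U.index ≠ 0 := hUfi.index_ne_zero
  -- a point `y₁` of `(S₀)_v` and its `Π_v`-orbit `O₁`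
  obtain ⟨e', -⟩ := IsVerticialHom.exists_equiv hψ S₀
  let κ' : (c.equiv.functor.obj S₀).obj.V ≃ c.G ⧸ V.toSubgroup :=
    BTemp.equivOfIso (c.equiv.counitIso.app X₀)
  let y₁ : (S₀.obj.SV v).obj.V := e'.symm (κ'.symm ((1 : c.G) : c.G ⧸ V.toSubgroup))
  let O₁ : Set (S₀.obj.SV v).obj.V := {y | ∃ γ : 𝒢.Gv v, (S₀.obj.SV v).obj.ρ γ y₁ = y}
  have hy₁ : y₁ ∈ O₁ := ⟨1, by rw [map_one]; rfl⟩
  let O : ∀ w : 𝒢.graph.Vertex, Set (S₀.obj.SV w).obj.V := Function.update (fun w => ∅) v O₁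
  have hOv : O v = O₁ := by simp only [O, Function.update_self]
  have hOw : ∀ w, w ≠ v → O w = ∅ := fun w hw => by simp only [O, Function.update_of_ne hw]
  have hOinv : ∀ (w : 𝒢.graph.Vertex) (γ : 𝒢.Gv w) (y : (S₀.obj.SV w).obj.V),
      (S₀.obj.SV w).obj.ρ γ y ∈ O w ↔ y ∈ O w := by
    intro w γ y
    by_cases hw : w = v
    · subst hw
      rw [hOv]
      constructor
      · rintro ⟨γ', h'⟩
        refine ⟨γ⁻¹ * γ', ?_⟩
        rw [map_mul]
        change (S₀.obj.SV w).obj.ρ γ⁻¹ ((S₀.obj.SV w).obj.ρ γ' y₁) = y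
        rw [h']
        change ((S₀.obj.SV w).obj.ρ γ⁻¹ * (S₀.obj.SV w).obj.ρ γ) y = y
        rw [← map_mul, inv_mul_cancel, map_one]
        rfl
      · rintro ⟨γ', h'⟩
        refine ⟨γ * γ', ?_⟩
        rw [map_mul]
        change (S₀.obj.SV w).obj.ρ γ ((S₀.obj.SV w).obj.ρ γ' y₁) = _
        rw [h']
    · rw [hOw w hw]
      simp
  -- STEP 3: elevatedness of `v`: `N ⊆ Π'_v` with `[N:1] > [Π_v : K₀]·[Π_v : U]`
  obtain ⟨A, hAepi, N, hMN, hNfree⟩ := h𝒢.isTotallyElevated v (K₀.index * U.index + 1)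
  obtain ⟨M₀, hM₀, hdvd⟩ := A.bounded
  have hNdvd : N.index ∣ M₀ := (Subgroup.index_dvd_card (H := N)).trans (hdvd v)
  -- STEP 4: the fibres — mixed (`Π'_v/N`-part at `v`) over `O`, universal elsewhere and off `O`
  let Nf : ∀ w : 𝒢.graph.Vertex, Subgroup (A.FV w) :=
    Function.update (fun w => (⊤ : Subgroup (A.FV w))) v N
  have hNf₁ : Nf v = N := by simp only [Nf, Function.update_self]
  let a : 𝒢.graph.Vertex → ℕ := fun w => if w = v then M₀ / N.index else 0
  let a' : 𝒢.graph.Vertex → ℕ := fun w =>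
    if w = v then M₀ / Nat.card (A.FV w) else 2 * M₀ / Nat.card (A.FV w)
  let a'' : 𝒢.graph.Vertex → ℕ := fun w => 2 * M₀ / Nat.card (A.FV w)
  let k : 𝒢.graph.Edge → ℕ := fun e => 2 * M₀ / Nat.card (A.FE e)
  have ha : ∀ w, w ≠ v → a w = 0 := fun w hw => if_neg hw
  have ha₁ : a v = M₀ / N.index := if_pos rfl
  have ha'₁ : a' v = M₀ / Nat.card (A.FV v) := if_pos rfl
  have ha' : ∀ w, w ≠ v → a' w = 2 * M₀ / Nat.card (A.FV w) := fun w hw => if_neg hw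
  have ha₁pos : 0 < a v := by
    rw [ha₁]; exact Nat.div_pos (Nat.le_of_dvd hM₀ hNdvd) Nat.card_pos
  have ha'₁pos : 0 < a' v := by
    rw [ha'₁]; exact Nat.div_pos (Nat.le_of_dvd hM₀ (hdvd v)) Nat.card_pos
  have hkE : ∀ (b : 𝒢.graph.Branch) (w : 𝒢.graph.Vertex), 𝒢.graph.abuts b = some w →
      Nat.card (A.FE (𝒢.graph.edgeOf b)) * k (𝒢.graph.edgeOf b) = 2 * M₀ := fun b w h =>
    Nat.mul_div_cancel' (((Subgroup.card_dvd_of_injective _ (A.brF_injective b w h)).trans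
      (hdvd w)).trans (dvd_mul_left M₀ 2))
  have hfreeO : ∀ (b : 𝒢.graph.Branch) (w : 𝒢.graph.Vertex) (h : 𝒢.graph.abuts b = some w)
      (f : A.FV w), 0 < a w → Nf w ⊓ ((A.brF b w h).range.map (MulAut.conj f).toMonoidHom) = ⊥ := by
    intro b w h f haw
    have hw : w = v := by
      by_contra hw; rw [ha w hw] at haw; exact lt_irrefl 0 haw
    subst hw
    rw [hNf₁]
    exact hNfree b h f
  have hcardO : ∀ (b : 𝒢.graph.Branch) (w : 𝒢.graph.Vertex), 𝒢.graph.abuts b = some w →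
      Nat.card (A.FE (𝒢.graph.edgeOf b)) * k (𝒢.graph.edgeOf b) =
        (Nf w).index * a w + Nat.card (A.FV w) * a' w := by
    intro b w h
    rw [hkE b w h]
    by_cases hw : w = v
    · subst hw
      rw [hNf₁, ha₁, ha'₁, Nat.mul_div_cancel' hNdvd, Nat.mul_div_cancel' (hdvd _), two_mul]
    · rw [ha w hw, ha' w hw, mul_zero, zero_add,
        Nat.mul_div_cancel' ((hdvd w).trans (dvd_mul_left M₀ 2))]
  have hcardD : ∀ (b : 𝒢.graph.Branch) (w : 𝒢.graph.Vertex), 𝒢.graph.abuts b = some w →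
      Nat.card (A.FE (𝒢.graph.edgeOf b)) * k (𝒢.graph.edgeOf b) =
        (⊤ : Subgroup (A.FV w)).index * 0 + Nat.card (A.FV w) * a'' w := by
    intro b w h
    rw [hkE b w h, mul_zero, zero_add, Nat.mul_div_cancel' ((hdvd w).trans (dvd_mul_left M₀ 2))]
  let σO : A.MixedSpec := ⟨Nf, a, a', k, hfreeO, hcardO⟩
  let σD : A.MixedSpec := ⟨fun _ => ⊤, fun _ => 0, a'', k, fun _ _ _ _ h0 => absurd h0 (lt_irrefl 0),
    hcardD⟩
  let R : A.RelGluingData S₀.obj :=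
    { D := σD.toGluingData
      XO := σO.toGluingData.XV
      actO := σO.toGluingData.actV
      finiteO := σO.toGluingData.finiteV
      free_O := σO.toGluingData.free_br
      card_O := σO.toGluingData.card_br
      O := O
      O_inv := hOinv }
  let S : BTempCat 𝒢 := R.tcov S₀.property
  let pr : S ⟶ S₀ := ObjectProperty.homMk R.projHom
  -- STEP 5: the identifications `S_v ≃ ψ^*X`, `(S₀)_v ≃ ψ^*X₀' ≅ Π/V` (natural, equivariant)
  obtain ⟨e, e₀, he, he₀, hnat⟩ := IsVerticialHom.exists_equiv_natural hψ pr
  letI := Action.instMulAction (c.equiv.functor.obj S).obj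
  letI := Action.instMulAction (c.equiv.functor.obj S₀).obj
  have he' : ∀ (γ : 𝒢.Gv v) (s : (S.obj.SV v).obj.V), e ((S.obj.SV v).obj.ρ γ s) = ψ γ • e s := he
  have he₀' : ∀ (γ : 𝒢.Gv v) (y : (S₀.obj.SV v).obj.V),
      e₀ ((S₀.obj.SV v).obj.ρ γ y) = ψ γ • e₀ y := he₀
  have hpr : ∀ (x : c.G) (z : (c.equiv.functor.obj S).obj.V),
      (c.equiv.functor.map pr).hom.hom.hom (x • z) = x • (c.equiv.functor.map pr).hom.hom.hom z :=
    fun x z => BTemp.hom_ρ_apply (c.equiv.functor.map pr) x z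
  have hκ : ∀ (x : c.G) (z : (c.equiv.functor.obj S₀).obj.V),
      κ' (x • z) = x • κ' z := fun x z => BTemp.equivOfIso_ρ _ x z
  let τ : (S₀.obj.SV v).obj.V ≃ c.G ⧸ V.toSubgroup := e₀.trans κ'
  have hτ : ∀ (γ : 𝒢.Gv v) (y : (S₀.obj.SV v).obj.V),
      τ ((S₀.obj.SV v).obj.ρ γ y) = ψ γ • τ y := fun γ y => by
    change κ' (e₀ _) = ψ γ • κ' (e₀ y)
    rw [he₀', hκ]
  have hstab : ∀ (γ : 𝒢.Gv v) (y : (S₀.obj.SV v).obj.V),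
      (S₀.obj.SV v).obj.ρ γ y = y ↔ γ ∈ U := by
    intro γ y
    rw [← τ.injective.eq_iff, hτ]
    obtain ⟨t, ht⟩ := QuotientGroup.mk_surjective (τ y)
    rw [← ht]
    change ((ψ γ * t : c.G) : c.G ⧸ V.toSubgroup) = t ↔ ψ γ ∈ V.toSubgroup
    rw [QuotientGroup.eq]
    constructor
    · intro h1
      have := V.toSubgroup.inv_mem (V.isNormal'.conj_mem _ h1 t)
      simpa [mul_assoc] using this
    · intro h1
      have := V.isNormal'.conj_mem _ (V.toSubgroup.inv_mem h1) t⁻¹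
      simpa [mul_assoc] using this
  have hOy₁ : y₁ ∈ R.O v := by change y₁ ∈ O v; rw [hOv]; exact hy₁
  let zN : (A.FV v ⧸ Nf v) × Fin (a v) ⊕ A.FV v × Fin (a' v) :=
    Sum.inl (((1 : A.FV v) : A.FV v ⧸ Nf v), ⟨0, ha₁pos⟩)
  let zF : (A.FV v ⧸ Nf v) × Fin (a v) ⊕ A.FV v × Fin (a' v) :=
    Sum.inr ((1 : A.FV v), ⟨0, ha'₁pos⟩)
  let p₀ : R.VTy v := Sum.inl (⟨y₁, hOy₁⟩, zN)
  let p₁ : R.VTy v := Sum.inl (⟨y₁, hOy₁⟩, zF)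
  let x₀ : (c.equiv.functor.obj S).obj.V := e p₀
  -- KEY: an element of `K₀` whose image lies in `N` and which lies in `U` maps to `1` in `Π'_v`
  have key : ∀ γ : 𝒢.Gv v, γ ∈ K₀ → γ ∈ U → A.πV v γ ∈ Nf v → A.πV v γ = 1 := by
    intro γ hγK hγU hγN
    obtain ⟨δ, hδ⟩ := hK₀mem γ hγK
    -- `γ` fixes `p₀`, so `ψ γ = g ψδ g⁻¹` fixes `x₀`, so `ψ δ` fixes `g⁻¹ x₀`
    have h1 : (S.obj.SV v).obj.ρ γ p₀ = p₀ := by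
      change (R.objV v).obj.ρ γ (Sum.inl (⟨y₁, hOy₁⟩, zN) : R.VTy v) = Sum.inl (⟨y₁, hOy₁⟩, zN)
      rw [R.objV_ρ_inl]
      refine congrArg Sum.inl (Prod.ext (Subtype.ext ((hstab γ y₁).mpr hγU)) ?_)
      change (Sum.inl (A.πV v γ • ((1 : A.FV v) : A.FV v ⧸ Nf v), (⟨0, ha₁pos⟩ : Fin (a v))) :
        (A.FV v ⧸ Nf v) × Fin (a v) ⊕ A.FV v × Fin (a' v)) = zN
      rw [MulAction.Quotient.smul_mk, smul_eq_mul, mul_one]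
      refine congrArg Sum.inl (Prod.ext ?_ rfl)
      change ((A.πV v γ : A.FV v) : A.FV v ⧸ Nf v) = ((1 : A.FV v) : A.FV v ⧸ Nf v)
      rw [QuotientGroup.eq, mul_one]
      exact (Nf v).inv_mem hγN
    have h2 : ψ δ • g⁻¹ • x₀ = g⁻¹ • x₀ := by
      have : ψ γ • x₀ = x₀ := by
        change ψ γ • e p₀ = e p₀
        rw [← he', h1]
      rw [← hδ, mul_smul, mul_smul, smul_eq_iff_eq_inv_smul] at this
      exact this
    -- the point `q` of `S_v` under `g⁻¹ x₀` lies over a point NOT in `O₁` (since `g ∉ HV`)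
    set q := e.symm (g⁻¹ • x₀) with hq
    have hq' : (S.obj.SV v).obj.ρ δ q = q := by
      apply e.injective
      rw [he', hq, Equiv.apply_symm_apply, h2]
    have hprq : τ ((pr.hom.fV v).hom.hom q) = g⁻¹ • τ y₁ := by
      change κ' (e₀ ((pr.hom.fV v).hom.hom q)) = g⁻¹ • κ' (e₀ y₁)
      have hp₀ : (pr.hom.fV v).hom.hom (p₀ : (S.obj.SV v).obj.V) = y₁ := rfl
      rw [hnat, hq, Equiv.apply_symm_apply, hpr, hκ, ← hp₀, hnat]
    -- hence `q` is in the universal part, over a point `y ∉ O₁`, and `δ ∈ U ∩ Ker(Π_v → Π'_v)`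
    have hδ' : δ ∈ U ∧ A.πV v δ = 1 := by
      clear_value q
      change R.VTy v at q
      rcases q with ⟨⟨y, hy⟩, z⟩ | ⟨⟨y, hy⟩, z⟩
      · -- over `O₁`: impossible since `g ∉ HV`
        exfalso
        have hy' : y ∈ O₁ := by rw [← hOv]; exact hy
        obtain ⟨γ', hγ'⟩ := hy'
        have h3 : ψ γ' • τ y₁ = g⁻¹ • τ y₁ := by
          rw [← hτ, hγ']
          exact hprq
        obtain ⟨t₁, ht₁⟩ := QuotientGroup.mk_surjective (τ y₁)
        rw [← ht₁] at h3
        change ((ψ γ' * t₁ : c.G) : c.G ⧸ V.toSubgroup) = ((g⁻¹ * t₁ : c.G) : c.G ⧸ V.toSubgroup) at h3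
        rw [QuotientGroup.eq] at h3
        -- `(ψγ' t₁)⁻¹ (g⁻¹ t₁) ∈ V` ⇒ `ψγ' · g ∈ V` ⇒ contradiction with `g ∉ HV`
        have h4 : (ψ γ')⁻¹ * g⁻¹ ∈ V.toSubgroup := by
          have := V.isNormal'.conj_mem _ h3 t₁
          simpa [mul_assoc] using this
        have h5' : g * ψ γ' ∈ V.toSubgroup := by
          have := V.toSubgroup.inv_mem h4
          simpa [mul_inv_rev] using this
        have h5 : ψ γ' * g ∈ V.toSubgroup := by
          have := V.isNormal'.conj_mem _ h5' (ψ γ')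
          simpa [mul_assoc] using this
        have h6 : ((ψ γ')⁻¹)⁻¹ * g ∈ (V : Set c.G) := by
          rw [inv_inv]
          exact h5
        exact hV (ψ γ')⁻¹ (H.inv_mem ⟨γ', rfl⟩) h6
      · -- universal part
        change (R.objV v).obj.ρ δ (Sum.inr (⟨y, hy⟩, z) : R.VTy v) = Sum.inr (⟨y, hy⟩, z) at hq'
        rw [R.objV_ρ_inr] at hq'
        have h3 := Sum.inr.inj hq'
        refine ⟨(hstab δ y).mp (congrArg (fun p => p.1.1) h3), ?_⟩
        have h4 : A.πV v δ • z = z := congrArg Prod.snd h3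
        change (A.FV v ⧸ (⊤ : Subgroup (A.FV v))) × Fin 0 ⊕ A.FV v × Fin (a'' v) at z
        rcases z with ⟨q', i⟩ | ⟨f, i⟩
        · exact i.elim0
        · change (Sum.inr (A.πV v δ * f, i) : (A.FV v ⧸ (⊤ : Subgroup (A.FV v))) × Fin 0 ⊕
            A.FV v × Fin (a'' v)) = Sum.inr (f, i) at h4
          exact mul_eq_right.mp (congrArg Prod.fst (Sum.inr.inj h4))
    -- so `δ` acts trivially on `S_v`, hence `ψ δ`, hence `ψ γ = g ψδ g⁻¹`, on `X`; test on `p₁`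
    have h5 : ∀ s : (S.obj.SV v).obj.V, (S.obj.SV v).obj.ρ δ s = s := by
      intro s
      change R.VTy v at s
      rcases s with ⟨⟨y, hy⟩, z⟩ | ⟨⟨y, hy⟩, z⟩
      · change (R.objV v).obj.ρ δ (Sum.inl (⟨y, hy⟩, z) : R.VTy v) = Sum.inl (⟨y, hy⟩, z)
        rw [R.objV_ρ_inl]
        exact congrArg Sum.inl (Prod.ext (Subtype.ext ((hstab δ y).mpr hδ'.1))
          (by rw [hδ'.2, one_smul]))
      · change (R.objV v).obj.ρ δ (Sum.inr (⟨y, hy⟩, z) : R.VTy v) = Sum.inr (⟨y, hy⟩, z)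
        rw [R.objV_ρ_inr]
        exact congrArg Sum.inr (Prod.ext (Subtype.ext ((hstab δ y).mpr hδ'.1))
          (by rw [hδ'.2, one_smul]))
    have h6 : ∀ x : (c.equiv.functor.obj S).obj.V, ψ γ • x = x := by
      intro x
      have hδx : ∀ x' : (c.equiv.functor.obj S).obj.V, ψ δ • x' = x' := fun x' => by
        obtain ⟨s, rfl⟩ := e.surjective x'
        rw [← he', h5]
      rw [← hδ, mul_smul, mul_smul, hδx, smul_inv_smul]
    have h7 : (S.obj.SV v).obj.ρ γ p₁ = p₁ := by
      apply e.injective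
      rw [he', h6]
    change (R.objV v).obj.ρ γ (Sum.inl (⟨y₁, hOy₁⟩, zF) : R.VTy v) = Sum.inl (⟨y₁, hOy₁⟩, zF) at h7
    rw [R.objV_ρ_inl] at h7
    have h8 := congrArg Prod.snd (Sum.inl.inj h7)
    change (Sum.inr (A.πV v γ * 1, (⟨0, ha'₁pos⟩ : Fin (a' v))) :
      (A.FV v ⧸ Nf v) × Fin (a v) ⊕ A.FV v × Fin (a' v)) = Sum.inr (1, ⟨0, ha'₁pos⟩) at h8
    have h9 := congrArg Prod.fst (Sum.inr.inj h8)
    rwa [mul_one] at h9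
  -- COUNTING in `Π_v` (p. 29): `I₀ = U ∩ π⁻¹(N)` (isotropy of `x₀` in `Π_v`), `L₀ = Ker π`
  let π : 𝒢.Gv v →* A.FV v := A.πV v
  let I₀ : Subgroup (𝒢.Gv v) := U ⊓ (Nf v).comap π
  let L₀ : Subgroup (𝒢.Gv v) := π.ker
  have hKI : K₀ ⊓ I₀ ≤ L₀ := fun γ hγ =>
    (MonoidHom.mem_ker).mpr (key γ hγ.1 hγ.2.1 (Subgroup.mem_comap.mp hγ.2.2))
  have hsurj : Function.Surjective π := hAepi.1 v
  have hcount : L₀.relIndex I₀ = Nat.card ↥(Nf v ⊓ U.map π) := by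
    change ((π.ker).subgroupOf I₀).index = _
    rw [Subgroup.subgroupOf, MonoidHom.comap_ker, Subgroup.index_ker, MonoidHom.range_comp,
      Subgroup.range_subtype, map_inf_comap_eq, inf_comm]
  have hW : (U.map π).index ≤ U.index :=
    Nat.le_of_dvd (Nat.pos_of_ne_zero hUne) (U.index_map_dvd hsurj)
  have hlow : K₀.index < Nat.card ↥(Nf v ⊓ U.map π) := by
    have h1 := card_le_card_inf_mul_index (Nf v) (U.map π)
    have hN' : Nat.card ↥(Nf v) = Nat.card N := by rw [hNf₁]
    have h2 : K₀.index * U.index < Nat.card ↥(Nf v ⊓ U.map π) * U.index :=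
      calc K₀.index * U.index < Nat.card N := hMN
        _ = Nat.card ↥(Nf v) := hN'.symm
        _ ≤ Nat.card ↥(Nf v ⊓ U.map π) * (U.map π).index := h1
        _ ≤ Nat.card ↥(Nf v ⊓ U.map π) * U.index := Nat.mul_le_mul_left _ hW
    exact Nat.lt_of_mul_lt_mul_right h2
  -- upper bound: `[I₀ : I₀ ∩ L₀] ≤ [I₀ : I₀ ∩ K₀] ≤ [Π_v : K₀]`
  have h9 : K₀.relIndex I₀ ≤ K₀.index := by
    rw [← Subgroup.relIndex_top_right]
    exact Subgroup.relIndex_le_of_le_right le_top (by rwa [Subgroup.relIndex_top_right])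
  have hfin : K₀.relIndex I₀ ≠ 0 := fun h0 =>
    hK₀ne (by
      rw [← Subgroup.relIndex_top_right]
      exact Subgroup.relIndex_eq_zero_of_le_right le_top h0)
  have h8 : (K₀ ⊓ I₀).relIndex I₀ = K₀.relIndex I₀ := Subgroup.inf_relIndex_right _ _
  have h7 : L₀.relIndex I₀ ≤ (K₀ ⊓ I₀).relIndex I₀ :=
    Subgroup.relIndex_le_of_le_left hKI (by rwa [h8])
  rw [hcount, h8] at h7
  omega

/-- **Theorem 3.7 (ii), same vertex, general cosets**: for `g₁⁻¹ g₂ ∉ H = ψ(Π_v)`,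
`g₁ H g₁⁻¹ ∩ g₂ H g₂⁻¹` has infinite index in `g₁ H g₁⁻¹` (conjugate by `g₁⁻¹` and apply
`relIndex_conj_eq_zero`). [cite: MochizukiSemiAnbd2006, Thm 3.7(ii) p.40] -/
theorem relIndex_conj_conj_eq_zero (h𝒢 : 𝒢.Prop36Hypotheses) (c : TemperedPiChart 𝒢)
    (v : 𝒢.graph.Vertex) {H : Subgroup c.G} (hH : H ∈ verticialSubgroups c v) (g₁ g₂ : c.G)
    (hg : g₁⁻¹ * g₂ ∉ H) :
    (H.map (MulAut.conj g₂).toMonoidHom).relIndex (H.map (MulAut.conj g₁).toMonoidHom) = 0 := by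
  obtain ⟨ψ, hψ, rfl⟩ := hH
  have h := relIndex_conj_eq_zero h𝒢 c v hψ hg
  have hinj : Function.Injective (MulAut.conj g₁).toMonoidHom := (MulAut.conj g₁).injective
  rw [← Subgroup.relIndex_map_map_of_injective _ _ hinj, Subgroup.map_map] at h
  have hc : (MulAut.conj g₁).toMonoidHom.comp (MulAut.conj (g₁⁻¹ * g₂)).toMonoidHom =
      (MulAut.conj g₂).toMonoidHom := by
    ext x
    simp [MulAut.conj_apply, mul_assoc]
  rw [hc] at h
  exact h

/-- **Theorem 3.7 (ii)** ([SemiAnbd] §3 p. 40) as typed — the named fact `VerticialDistinct` of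
`TemperedVerticial.lean` — PROVED: both clauses (`relIndex_eq_zero_of_ne` for distinct vertices,
`relIndex_conj_conj_eq_zero` for one vertex and distinct cosets).
[cite: MochizukiSemiAnbd2006, Thm 3.7(ii) p.40] -/
theorem verticialDistinct_holds : VerticialDistinct.{u} :=
  verticialDistinct_iff_sameVertex.mpr fun _ h𝒢 c v _ hH g₁ g₂ hg =>
    relIndex_conj_conj_eq_zero h𝒢.toProp36Hypotheses c v hH g₁ g₂ hg

end ProfiniteSemiGraph

end Literature.AnabelianGeometry.SemiGraphs
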